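import Summits.BirchSwinnertonDyer.BirchSwinnertonDyer.Theorems.AlignedTransportAtTwoMainConjectureOfRankZeroBSDAtTwoCubicRelationDoor
import Literature.NumberTheory.IwasawaTheory.ClassGroupPRankLeOfRelationLayerOne
import HarnessLib

/-!
# Route `AlignedTransportAtTwo`, crux C2 `MainConjectureOfRankZeroBSDAtTwo` (stmt-BirchSwinnertonDyer-22298):
# THE RELATION DOOR ON THE SPLIT (KILFORD) STRATUM `Δ_min ≡ 1 (mod 8)` — three primes above `2` in `ℚ(β)`: ONE unit `≡ ±3 (mod 𝔭'³)` at one of them,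
# the genus certificate at another, ONE relation of order `d ≤ 2^m − 2` at any layer `K_m` ⟹ `rank₂ Cl(K_l) ≤ d ∀ l`, `μ₂ = 0`, `λ₂ ≤ d`

HONEST FRAMING (cell `bsd-f1-sign2`, WIDTH-5 attached prover seat `bsd-line-att-p3` gen 53 on line `birth` of the lead `bsd-line-att-p2`; `--supports`
stmt-BirchSwinnertonDyer-22298, closes nothing; BSD is NOT proved by any of this; the crux C2, its verdict «blocked-on `Rank1Residual.GreenbergMuConjectureIrreducible`»
and every registered stub are untouched).  THEOREMS ONLY — no definition, no named fact, no `sorry`.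

WHAT.  The `W`-level form of this seat's Literature theorems `IwasawaTheory.classicalMuVanishes_two_of_relation_of_genusCert_of_sub_three_mem_layer_one` and
`IwasawaTheory.classicalMuVanishes_and_classicalLambda_le_of_relation_of_classGroupPRank_one_le_one` (`IwasawaTheory/ClassGroupPRankLeOfRelationLayerOne`, g53: the
relation door whose coinvariant input is read at the FIRST layer `K_1 = K(√2)` — `NumberFields/GenusCoinvariantIndexLayerOne`, Washington §13.3 Lemma 13.15/13.18 modulo
`𝔪`), the split-stratum sister of att-p3 g48/g49's `…CubicRelationDoor.classicalMuVanishes_adjoin_of_relation_of_genusCert_layer_anyDepth` (there: `Δ_min ≡ 5 (mod 8)`,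
`2 = 𝔭₁𝔭₂`, genus cyclicity from TWO ramified primes).  Here `Δ_min ≡ 1 (mod 8)`: ON the Kilford stratum `ℚ(β)` has THREE primes above `2`
(att-p5 g26 `…CubicKilfordPrimes.ncard_eq_three_of_onKilfordStratumAtTwo`), all totally ramified in the cyclotomic `ℤ₂`-tower, Chevalley's count of ambiguous classes is
`≥ 4` from layer `2` on and no two-prime cyclicity is available; instead the `Gal`-coinvariants of `Cl(K_m)/2` are read at `K_1`, where they are cyclic as soon as ONE unit
of `ℚ(β)` is not a norm from `K_1` — i.e. `≡ ±3 (mod 𝔭'³)` at ONE dyadic prime `𝔭'` (`(ε, 2)_{𝔭'} = −1`; by the product formula then at exactly two of the three).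

* **`classicalMuVanishes_adjoin_of_relation_of_genusCert_of_sub_three_mem_splitStratum`** — `W` globally minimal, good ordinary at `2`, no rational `2`-torsion abscissa,
  **`Δ_min ≡ 1 (mod 8)`**, `Δ_W < 0`, `β` a root of the `2`-division cubic, `K = ℚ(β)`; displayed data of `K`: `h_K` odd, `2 ∤ d_K`; `𝔭'` of norm `2` and a unit
  **`ε' ≡ ±3 (mod 𝔭'³)`**; `𝔭₁` of norm `2` and a unit `ε ≡ ±1 (mod 𝔭₁³)` with `±ε` non-squares (so every unit is `≡ ±1 (mod 𝔭₁³)`); `κ` a cyclotomic `ℤ₂`-extension of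
  `K` (any compatible algebra structure `K_1 → K_m`, `1 ≤ m`); a class `c ∈ Cl(K_m)` with the GENUS CERTIFICATE `(𝔄, k, π)` (`N_{K_m/K_1} c = [𝔄]`, `N_{K_1/K}(𝔄)^k = (π)`,
  `π ≡ ±3 (mod 𝔭₁³)`); `σ` a generator of `Gal(K_m/K)`; ONE relation `∏_{i<N} σ^i(c)^{f_i} = 1` with `∑ f_i X^i = (X−1)^d·u + 2g`, `u(1)` odd, `d + 2 ≤ 2^m` ⟹
  **`rank₂ Cl(K_l) ≤ d ∀ l`, `μ₂(κ) = 0`, `λ₂(κ) ≤ d`.**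
* **`classicalMuVanishes_adjoin_of_relation_of_genusCert_of_classGroupPRank_one_le_one`** — EITHER stratum (`Δ_min` odd is not even needed): the same with the unit bit
  replaced by the class-group datum **`rank₂ Cl(K_1) ≤ 1`** of the sextic field `K_1 = ℚ(β, √2)`.

CELL READING (split stratum, where all 17 TURNKEY seeds of `…CertifiedSeedsRows{,B}` / `…AlignedPairSeedsB` live and no kernel `μ₂ = 0` certificate in class-group
currency existed): with `ε` the fundamental unit and `bᵢ = [ιᵢ(ε) ≡ ±3 (mod 8)]` at the three dyadic embeddings, `Σ bᵢ` is even; `r := rank₂ Cl(K_1) = 1 ⟺ (b₁,b₂,b₃) ≠ (0,0,0)`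
— the door's habitat (`𝔭'` a prime with bit `1`, `𝔭₁` the prime with bit `0`); `r = 2` (all bits `0`, e.g. `1727a1`) needs a two-generator certificate and is NOT covered.
Per-seed rows (the relation in `Cl(K_m)`, degree `6·2^{m-1}… = 12` at `m = 2`) are left to successors; the recipe is the docstring above.  CONDITIONAL on displayed data only
(no PRINT fact); nothing is asserted about any curve; nothing is closed; BSD is not proved.

References: [Washington1997] §13.1 Prop. 13.2, §13.3 Lemmas 13.15, 13.18, Prop. 13.22–13.23; [Lang1990] Ch. 13 §4 Lemma 4.1; [Gras2003] IV.4; [Fukuda1994] Thm. 1;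
[Omeara1963] §63B (63:10); [NeukirchANT1999] Ch. I §8 (8.2), Ch. II §8 (8.1)–(8.3), Ch. III (2.12); tree: this seat's Literature files `NumberFields/GenusCoinvariantIndexLayerOne`
(p833523), `IwasawaTheory/ClassGroupPRankLeOfRelationLayerOne` (p833684); att-p3 g48/g49 `…CubicRelationDoor` (template); att-p5 g26 `…CubicKilfordPrimes`.
-/

set_option linter.dupNamespace false
set_option autoImplicit false

noncomputable section

open scoped Classical NumberField nonZeroDivisors

namespace Summit.BirchSwinnertonDyer.BirchSwinnertonDyer.Theorems.AlignedTransportAtTwoCubicSplitStratumRelationDoor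

open NumberField IsDedekindDomain Polynomial WeierstrassCurve IntermediateField CongruenceSubgroup Finset
  Literature.NumberTheory.IwasawaTheory Literature.NumberTheory.GaloisRepresentations
  Literature.NumberTheory.GaloisRepresentations.Herbrand Literature.NumberTheory.GaloisRepresentations.MinkowskiUnit
  Literature.NumberTheory.GaloisRepresentations.CyclicNormIndex
  Literature.NumberTheory.EllipticCurves Literature.NumberTheory.EllipticCurves.Greenberg1999
  Literature.NumberTheory.EllipticCurves.ModularForms
  Literature.NumberTheory.EllipticCurves.Rank1Residual
  Literature.NumberTheory.EllipticCurves.Module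
  Literature.NumberTheory.NumberFields Literature.NumberTheory.NumberFields.AmbiguousClass
  Summit.BirchSwinnertonDyer.Rank1Residual
  Summit.BirchSwinnertonDyer.Rank1Residual.X1.MuLambda
  Summit.BirchSwinnertonDyer.Rank1Residual.X5
  Summit.BirchSwinnertonDyer.Rank1Residual.F1Sign2
  Summit.BirchSwinnertonDyer.BirchSwinnertonDyer.Theorems.Rank1ResidualX1Defs
  Summit.BirchSwinnertonDyer.BirchSwinnertonDyer.Theses.AlignedTransportAtTwo
  Summit.BirchSwinnertonDyer.BirchSwinnertonDyer.Theorems.AlignedTransportAtTwoKilfordStratumShared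
  Summit.BirchSwinnertonDyer.BirchSwinnertonDyer.Theorems.AlignedTransportAtTwoCubicCarrierRoad
  Summit.BirchSwinnertonDyer.BirchSwinnertonDyer.Theorems.AlignedTransportAtTwoCubicKilfordPrimes
  Summit.BirchSwinnertonDyer.BirchSwinnertonDyer.Theorems.AlignedTransportAtTwoCubicDepthDoorGenusCert
  Summit.BirchSwinnertonDyer.BirchSwinnertonDyer.Theorems.AlignedTransportAtTwoCubicPrimesOfEmbeddings
  Summit.BirchSwinnertonDyer.BirchSwinnertonDyer.Theorems.AlignedTransportAtTwoCubicLayerOneDoors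

variable (W : WeierstrassCurve ℚ) [W.IsElliptic] [W.IsGloballyMinimal]

/-! ## §1 The split stratum: the non-norm unit bit at one dyadic prime, the genus certificate at another -/

set_option synthInstance.maxHeartbeats 400000 in
set_option maxHeartbeats 1600000 in
/-- **THE RELATION DOOR ON THE SPLIT STRATUM.**  `W/ℚ` globally minimal, good ordinary at `2`, no rational `2`-torsion abscissa, **`Δ_min ≡ 1 (mod 8)`** (ON the Kilford
stratum: three primes of `ℚ(β)` above `2`), `Δ_W < 0` (unit rank one), `β ∈ ℚ̄` a root of the `2`-division cubic, `K = ℚ(β)`; displayed: `h_K` odd, `2 ∤ d_K`; an ideal `𝔭'`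
of norm `2` and a unit **`ε' ≡ ±3 (mod 𝔭'³)`** (the non-norm bit); an ideal `𝔭₁` of norm `2` and a unit `ε ≡ ±1 (mod 𝔭₁³)` with `±ε` non-squares; `κ` a cyclotomic
`ℤ₂`-extension of `K`, a layer `m ≥ 1` with any compatible algebra structure `K_1 → K_m`; a class `c ∈ Cl(K_m)` with the GENUS CERTIFICATE: `𝔄 ≠ 0` an ideal of `𝓞_{K_1}` with
`N_{K_m/K_1} c = [𝔄]`, `N_{K_1/K}(𝔄)^k = (π)`, `π ≡ ±3 (mod 𝔭₁³)`; `σ` a generator of `Gal(K_m/K)`; and **ONE RELATION `∏_{i<N} σ^i(c)^{f_i} = 1`** with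
`∑ f_i X^i = (X−1)^d·u + 2·g`, `u(1)` odd, `d + 2 ≤ 2^m`.  THEN `rank₂ Cl(K_l) ≤ d` for every `l`, `μ₂(κ) = 0` and `λ₂(κ) ≤ d`. [cite: Washington1997, §13.3 Lemmas 13.15, 13.18,
Prop. 13.22–13.23] [cite: Lang1990, Ch. 13 §4, Lemma 4.1 (PDF pp. 203–204)] [cite: Gras2003, IV.4] [cite: Omeara1963, §63B (63:10)] [cite: Fukuda1994, Thm. 1, p. 264]
[cite: NeukirchANT1999, Ch. II §8 (8.1)–(8.3)] -/
theorem classicalMuVanishes_adjoin_of_relation_of_genusCert_of_sub_three_mem_splitStratum (hord : IsOrdinaryAt W 2)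
    (ht : ∀ x : ℚ, ¬ HasRationalTwoTorsionX W x) (h81 : minimalDiscriminantInt W % 8 = 1) (hΔ : W.Δ < 0)
    {β : AlgebraicClosure ℚ} (hβ : aeval β W.twoTorsionPolynomial.toPoly = 0)
    (hh : haveI : FiniteDimensional ℚ ↥(IntermediateField.adjoin ℚ ({β} : Set (AlgebraicClosure ℚ))) :=
        IntermediateField.adjoin.finiteDimensional ((AlgebraicClosure.isAlgebraic ℚ).isAlgebraic β).isIntegral
      haveI : NumberField ↥(IntermediateField.adjoin ℚ ({β} : Set (AlgebraicClosure ℚ))) := NumberField.mk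
      ¬ 2 ∣ classNumber ↥(IntermediateField.adjoin ℚ ({β} : Set (AlgebraicClosure ℚ))))
    (hd : haveI : FiniteDimensional ℚ ↥(IntermediateField.adjoin ℚ ({β} : Set (AlgebraicClosure ℚ))) :=
        IntermediateField.adjoin.finiteDimensional ((AlgebraicClosure.isAlgebraic ℚ).isAlgebraic β).isIntegral
      haveI : NumberField ↥(IntermediateField.adjoin ℚ ({β} : Set (AlgebraicClosure ℚ))) := NumberField.mk
      ¬ (2 : ℤ) ∣ NumberField.discr ↥(IntermediateField.adjoin ℚ ({β} : Set (AlgebraicClosure ℚ))))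
    (𝔭' : Ideal (𝓞 ↥(IntermediateField.adjoin ℚ ({β} : Set (AlgebraicClosure ℚ)))))
    (hN' : haveI : FiniteDimensional ℚ ↥(IntermediateField.adjoin ℚ ({β} : Set (AlgebraicClosure ℚ))) :=
        IntermediateField.adjoin.finiteDimensional ((AlgebraicClosure.isAlgebraic ℚ).isAlgebraic β).isIntegral
      haveI : NumberField ↥(IntermediateField.adjoin ℚ ({β} : Set (AlgebraicClosure ℚ))) := NumberField.mk
      Ideal.absNorm 𝔭' = 2)
    {ε' : (𝓞 ↥(IntermediateField.adjoin ℚ ({β} : Set (AlgebraicClosure ℚ))))ˣ}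
    (hε' : (ε' : 𝓞 ↥(IntermediateField.adjoin ℚ ({β} : Set (AlgebraicClosure ℚ)))) - 3 ∈ 𝔭' ^ 3 ∨
      (ε' : 𝓞 ↥(IntermediateField.adjoin ℚ ({β} : Set (AlgebraicClosure ℚ)))) + 3 ∈ 𝔭' ^ 3)
    (𝔭₁ : Ideal (𝓞 ↥(IntermediateField.adjoin ℚ ({β} : Set (AlgebraicClosure ℚ)))))
    (hN : haveI : FiniteDimensional ℚ ↥(IntermediateField.adjoin ℚ ({β} : Set (AlgebraicClosure ℚ))) :=
        IntermediateField.adjoin.finiteDimensional ((AlgebraicClosure.isAlgebraic ℚ).isAlgebraic β).isIntegral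
      haveI : NumberField ↥(IntermediateField.adjoin ℚ ({β} : Set (AlgebraicClosure ℚ))) := NumberField.mk
      Ideal.absNorm 𝔭₁ = 2)
    {ε : (𝓞 ↥(IntermediateField.adjoin ℚ ({β} : Set (AlgebraicClosure ℚ))))ˣ}
    (hε : (ε : 𝓞 ↥(IntermediateField.adjoin ℚ ({β} : Set (AlgebraicClosure ℚ)))) - 1 ∈ 𝔭₁ ^ 3 ∨
      (ε : 𝓞 ↥(IntermediateField.adjoin ℚ ({β} : Set (AlgebraicClosure ℚ)))) + 1 ∈ 𝔭₁ ^ 3)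
    (hnsq : ∀ z : (𝓞 ↥(IntermediateField.adjoin ℚ ({β} : Set (AlgebraicClosure ℚ))))ˣ, ε ≠ z ^ 2 ∧ ε ≠ -z ^ 2)
    (κP : ZpExtension ↥(IntermediateField.adjoin ℚ ({β} : Set (AlgebraicClosure ℚ))) 2) (hκP : κP.IsCyclotomic) {m : ℕ} (hm : 1 ≤ m)
    [NumberField (κP.layer 1)] [NumberField (κP.layer m)] [Algebra (κP.layer 1) (κP.layer m)]
    [IsScalarTower ↥(IntermediateField.adjoin ℚ ({β} : Set (AlgebraicClosure ℚ))) (κP.layer 1) (κP.layer m)]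
    {π : 𝓞 ↥(IntermediateField.adjoin ℚ ({β} : Set (AlgebraicClosure ℚ)))} (hπ : π - 3 ∈ 𝔭₁ ^ 3 ∨ π + 3 ∈ 𝔭₁ ^ 3)
    {A : Ideal (𝓞 (κP.layer 1))} (hA0 : A ≠ ⊥) {k : ℕ}
    (hA : haveI : FiniteDimensional ℚ ↥(IntermediateField.adjoin ℚ ({β} : Set (AlgebraicClosure ℚ))) :=
        IntermediateField.adjoin.finiteDimensional ((AlgebraicClosure.isAlgebraic ℚ).isAlgebraic β).isIntegral
      haveI : NumberField ↥(IntermediateField.adjoin ℚ ({β} : Set (AlgebraicClosure ℚ))) := NumberField.mk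
      Ideal.relNorm (𝓞 ↥(IntermediateField.adjoin ℚ ({β} : Set (AlgebraicClosure ℚ)))) A ^ k = Ideal.span {π})
    (σ : (κP.layer m) ≃ₐ[↥(IntermediateField.adjoin ℚ ({β} : Set (AlgebraicClosure ℚ)))] (κP.layer m))
    (hσ : ∀ τ : (κP.layer m) ≃ₐ[↥(IntermediateField.adjoin ℚ ({β} : Set (AlgebraicClosure ℚ)))] (κP.layer m), τ ∈ Subgroup.zpowers σ)
    {c : ClassGroup (𝓞 (κP.layer m))}
    (hcA : classGroupNorm (κP.layer 1) (κP.layer m) c = ClassGroup.mk0 ⟨A, mem_nonZeroDivisors_of_ne_zero hA0⟩)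
    {N d : ℕ} (hd2 : d + 2 ≤ 2 ^ m) {f : ℕ → ℤ} {u g : ℤ[X]} (hu : ¬ (2 : ℤ) ∣ u.eval 1)
    (hF : (∑ i ∈ range N, C (f i) * X ^ i : ℤ[X]) = (X - 1) ^ d * u + C (2 : ℤ) * g)
    (hrel : ∏ i ∈ range N, (ClassGroup.mulEquiv (intAut (σ ^ i)) c) ^ (f i) = 1) :
    (∀ l, classGroupPRank κP l ≤ d) ∧ ClassicalMuVanishes κP ∧ classicalLambda κP ≤ d := by
  have hirr := AlignedTransportAtTwoSeed.irr_two_of_forall_not_hasRationalTwoTorsionX W ht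
  have hβint : IsIntegral ℚ β := ((AlgebraicClosure.isAlgebraic ℚ).isAlgebraic β).isIntegral
  haveI : FiniteDimensional ℚ ↥(IntermediateField.adjoin ℚ ({β} : Set (AlgebraicClosure ℚ))) := IntermediateField.adjoin.finiteDimensional hβint
  haveI : NumberField ↥(IntermediateField.adjoin ℚ ({β} : Set (AlgebraicClosure ℚ))) := NumberField.mk
  haveI : Fact (Nat.Prime 2) := ⟨Nat.prime_two⟩
  have h3 : Module.finrank ℚ ↥(IntermediateField.adjoin ℚ ({β} : Set (AlgebraicClosure ℚ))) = 3 :=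
    AddKatoTwo.finrank_adjoin_root_twoTorsionPolynomial_eq_three W hirr hβ
  have hodd3 : ¬ 2 ∣ Module.finrank ℚ ↥(IntermediateField.adjoin ℚ ({β} : Set (AlgebraicClosure ℚ))) := by rw [h3]; decide
  have hoddK : Odd (Module.finrank ℚ ↥(IntermediateField.adjoin ℚ ({β} : Set (AlgebraicClosure ℚ)))) :=
    Nat.odd_iff.mpr (Nat.two_dvd_ne_zero.mp hodd3)
  -- unit rank `1` (`Δ_W < 0`: one real place)
  have hrank : Units.rank ↥(IntermediateField.adjoin ℚ ({β} : Set (AlgebraicClosure ℚ))) = 1 :=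
    units_rank_eq_one_of_nrRealPlaces_eq_one _ h3 (nrRealPlaces_adjoin_root_twoTorsionPolynomial_eq_one W hΔ hirr hβ)
  -- exactly three primes above `2` (`Δ_min ≡ 1 (mod 8)`: ON the Kilford stratum)
  have hs := (onKilfordStratumAtTwo_iff_minimalDiscriminantInt_emod_eight W hord).mpr h81
  have h3card := AlignedTransportAtTwoCubicKilfordPrimes.ncard_eq_three_of_onKilfordStratumAtTwo W hord ht hs h3
    (AlignedTransportAtTwoCubicKilfordPrimes.aeval_four_mul_gen_twoDivisionUCubic W hβ)
  -- the dyadic prime `𝔭₁` of degree one; all units `≡ ±1 (mod 𝔭₁³)`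
  obtain ⟨h𝔭₁, hP0, h2P, hcard⟩ := isPrime_and_mem_of_absNorm_eq_two 𝔭₁ hN
  haveI := h𝔭₁
  haveI : 𝔭₁.IsMaximal := h𝔭₁.isMaximal hP0
  have hres := forall_mem_or_sub_one_mem_of_card_quotient_eq_two 𝔭₁ hcard
  have h2P' : (2 : 𝓞 ↥(IntermediateField.adjoin ℚ ({β} : Set (AlgebraicClosure ℚ)))) ∉ 𝔭₁ ^ 2 := two_not_mem_sq_of_not_dvd_discr hd 𝔭₁ h2P
  have hunits := forall_units_sub_one_mem_or_add_one_mem_of_rank_eq_one hoddK hrank 𝔭₁ hP0 hres h2P h2P' hε hnsq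
  -- the dyadic prime `𝔭'` of degree one
  obtain ⟨h𝔭', hP0', h2P'', hcard'⟩ := isPrime_and_mem_of_absNorm_eq_two 𝔭' hN'
  haveI := h𝔭'
  haveI : 𝔭'.IsMaximal := h𝔭'.isMaximal hP0'
  have hres' := forall_mem_or_sub_one_mem_of_card_quotient_eq_two 𝔭' hcard'
  exact classicalMuVanishes_two_of_relation_of_genusCert_of_sub_three_mem_layer_one hodd3 hd κP hκP h3card.le hh hm 𝔭' hres' h2P'' hε' 𝔭₁
    hres h2P hunits hπ hA0 hA σ hσ hcA hd2 hu hF hrel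

/-! ## §2 Either stratum: the class-group datum `rank₂ Cl(ℚ(β, √2)) ≤ 1` instead of the unit bit -/

omit [W.IsGloballyMinimal] in
set_option synthInstance.maxHeartbeats 400000 in
set_option maxHeartbeats 1600000 in
/-- **THE RELATION DOOR FROM `rank₂ Cl(K_1) ≤ 1`, EITHER STRATUM.**  `W/ℚ` globally minimal, no rational `2`-torsion abscissa, `Δ_W < 0`, `β` a root of the `2`-division
cubic, `K = ℚ(β)`; displayed: `h_K` odd, `2 ∤ d_K` (Fukuda index `0` for the cyclotomic tower), `𝔭₁` of norm `2`, a unit `ε ≡ ±1 (mod 𝔭₁³)` with `±ε` non-squares; `κ` a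
cyclotomic `ℤ₂`-extension with **`rank₂ Cl(K_1) ≤ 1`** (`K_1 = ℚ(β, √2)`); a layer `m ≥ 1`, a class `c ∈ Cl(K_m)` with the genus certificate `(𝔄, k, π)` at `𝔭₁`, `σ`
generating `Gal(K_m/K)`, ONE relation of order `d` with `d + 2 ≤ 2^m`.  THEN `rank₂ Cl(K_l) ≤ d ∀ l`, `μ₂(κ) = 0`, `λ₂(κ) ≤ d`.  (No ordinarity and no stratum hypothesis:
the number of dyadic primes is not used.) [cite: Washington1997, §13.3 Lemmas 13.15, 13.18, Prop. 13.22–13.23] [cite: Lang1990, Ch. 13 §4, Lemma 4.1 (PDF pp. 203–204)]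
[cite: Gras2003, IV.4] [cite: Fukuda1994, Thm. 1, p. 264] -/
theorem classicalMuVanishes_adjoin_of_relation_of_genusCert_of_classGroupPRank_one_le_one
    (ht : ∀ x : ℚ, ¬ HasRationalTwoTorsionX W x) (hΔ : W.Δ < 0)
    {β : AlgebraicClosure ℚ} (hβ : aeval β W.twoTorsionPolynomial.toPoly = 0)
    (hh : haveI : FiniteDimensional ℚ ↥(IntermediateField.adjoin ℚ ({β} : Set (AlgebraicClosure ℚ))) :=
        IntermediateField.adjoin.finiteDimensional ((AlgebraicClosure.isAlgebraic ℚ).isAlgebraic β).isIntegral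
      haveI : NumberField ↥(IntermediateField.adjoin ℚ ({β} : Set (AlgebraicClosure ℚ))) := NumberField.mk
      ¬ 2 ∣ classNumber ↥(IntermediateField.adjoin ℚ ({β} : Set (AlgebraicClosure ℚ))))
    (hd : haveI : FiniteDimensional ℚ ↥(IntermediateField.adjoin ℚ ({β} : Set (AlgebraicClosure ℚ))) :=
        IntermediateField.adjoin.finiteDimensional ((AlgebraicClosure.isAlgebraic ℚ).isAlgebraic β).isIntegral
      haveI : NumberField ↥(IntermediateField.adjoin ℚ ({β} : Set (AlgebraicClosure ℚ))) := NumberField.mk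
      ¬ (2 : ℤ) ∣ NumberField.discr ↥(IntermediateField.adjoin ℚ ({β} : Set (AlgebraicClosure ℚ))))
    (𝔭₁ : Ideal (𝓞 ↥(IntermediateField.adjoin ℚ ({β} : Set (AlgebraicClosure ℚ)))))
    (hN : haveI : FiniteDimensional ℚ ↥(IntermediateField.adjoin ℚ ({β} : Set (AlgebraicClosure ℚ))) :=
        IntermediateField.adjoin.finiteDimensional ((AlgebraicClosure.isAlgebraic ℚ).isAlgebraic β).isIntegral
      haveI : NumberField ↥(IntermediateField.adjoin ℚ ({β} : Set (AlgebraicClosure ℚ))) := NumberField.mk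
      Ideal.absNorm 𝔭₁ = 2)
    {ε : (𝓞 ↥(IntermediateField.adjoin ℚ ({β} : Set (AlgebraicClosure ℚ))))ˣ}
    (hε : (ε : 𝓞 ↥(IntermediateField.adjoin ℚ ({β} : Set (AlgebraicClosure ℚ)))) - 1 ∈ 𝔭₁ ^ 3 ∨
      (ε : 𝓞 ↥(IntermediateField.adjoin ℚ ({β} : Set (AlgebraicClosure ℚ)))) + 1 ∈ 𝔭₁ ^ 3)
    (hnsq : ∀ z : (𝓞 ↥(IntermediateField.adjoin ℚ ({β} : Set (AlgebraicClosure ℚ))))ˣ, ε ≠ z ^ 2 ∧ ε ≠ -z ^ 2)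
    (κP : ZpExtension ↥(IntermediateField.adjoin ℚ ({β} : Set (AlgebraicClosure ℚ))) 2) (hκP : κP.IsCyclotomic)
    (h1 : classGroupPRank κP 1 ≤ 1) {m : ℕ} (hm : 1 ≤ m)
    [NumberField (κP.layer 1)] [NumberField (κP.layer m)] [Algebra (κP.layer 1) (κP.layer m)]
    [IsScalarTower ↥(IntermediateField.adjoin ℚ ({β} : Set (AlgebraicClosure ℚ))) (κP.layer 1) (κP.layer m)]
    {π : 𝓞 ↥(IntermediateField.adjoin ℚ ({β} : Set (AlgebraicClosure ℚ)))} (hπ : π - 3 ∈ 𝔭₁ ^ 3 ∨ π + 3 ∈ 𝔭₁ ^ 3)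
    {A : Ideal (𝓞 (κP.layer 1))} (hA0 : A ≠ ⊥) {k : ℕ}
    (hA : haveI : FiniteDimensional ℚ ↥(IntermediateField.adjoin ℚ ({β} : Set (AlgebraicClosure ℚ))) :=
        IntermediateField.adjoin.finiteDimensional ((AlgebraicClosure.isAlgebraic ℚ).isAlgebraic β).isIntegral
      haveI : NumberField ↥(IntermediateField.adjoin ℚ ({β} : Set (AlgebraicClosure ℚ))) := NumberField.mk
      Ideal.relNorm (𝓞 ↥(IntermediateField.adjoin ℚ ({β} : Set (AlgebraicClosure ℚ)))) A ^ k = Ideal.span {π})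
    (σ : (κP.layer m) ≃ₐ[↥(IntermediateField.adjoin ℚ ({β} : Set (AlgebraicClosure ℚ)))] (κP.layer m))
    (hσ : ∀ τ : (κP.layer m) ≃ₐ[↥(IntermediateField.adjoin ℚ ({β} : Set (AlgebraicClosure ℚ)))] (κP.layer m), τ ∈ Subgroup.zpowers σ)
    {c : ClassGroup (𝓞 (κP.layer m))}
    (hcA : classGroupNorm (κP.layer 1) (κP.layer m) c = ClassGroup.mk0 ⟨A, mem_nonZeroDivisors_of_ne_zero hA0⟩)
    {N d : ℕ} (hd2 : d + 2 ≤ 2 ^ m) {f : ℕ → ℤ} {u g : ℤ[X]} (hu : ¬ (2 : ℤ) ∣ u.eval 1)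
    (hF : (∑ i ∈ range N, C (f i) * X ^ i : ℤ[X]) = (X - 1) ^ d * u + C (2 : ℤ) * g)
    (hrel : ∏ i ∈ range N, (ClassGroup.mulEquiv (intAut (σ ^ i)) c) ^ (f i) = 1) :
    (∀ l, classGroupPRank κP l ≤ d) ∧ ClassicalMuVanishes κP ∧ classicalLambda κP ≤ d := by
  have hirr := AlignedTransportAtTwoSeed.irr_two_of_forall_not_hasRationalTwoTorsionX W ht
  have hβint : IsIntegral ℚ β := ((AlgebraicClosure.isAlgebraic ℚ).isAlgebraic β).isIntegral
  haveI : FiniteDimensional ℚ ↥(IntermediateField.adjoin ℚ ({β} : Set (AlgebraicClosure ℚ))) := IntermediateField.adjoin.finiteDimensional hβint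
  haveI : NumberField ↥(IntermediateField.adjoin ℚ ({β} : Set (AlgebraicClosure ℚ))) := NumberField.mk
  haveI : Fact (Nat.Prime 2) := ⟨Nat.prime_two⟩
  have h3 : Module.finrank ℚ ↥(IntermediateField.adjoin ℚ ({β} : Set (AlgebraicClosure ℚ))) = 3 :=
    AddKatoTwo.finrank_adjoin_root_twoTorsionPolynomial_eq_three W hirr hβ
  have hodd3 : ¬ 2 ∣ Module.finrank ℚ ↥(IntermediateField.adjoin ℚ ({β} : Set (AlgebraicClosure ℚ))) := by rw [h3]; decide
  have hoddK : Odd (Module.finrank ℚ ↥(IntermediateField.adjoin ℚ ({β} : Set (AlgebraicClosure ℚ)))) :=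
    Nat.odd_iff.mpr (Nat.two_dvd_ne_zero.mp hodd3)
  have hrank : Units.rank ↥(IntermediateField.adjoin ℚ ({β} : Set (AlgebraicClosure ℚ))) = 1 :=
    units_rank_eq_one_of_nrRealPlaces_eq_one _ h3 (nrRealPlaces_adjoin_root_twoTorsionPolynomial_eq_one W hΔ hirr hβ)
  obtain ⟨h𝔭₁, hP0, h2P, hcard⟩ := isPrime_and_mem_of_absNorm_eq_two 𝔭₁ hN
  haveI := h𝔭₁
  haveI : 𝔭₁.IsMaximal := h𝔭₁.isMaximal hP0
  have hres := forall_mem_or_sub_one_mem_of_card_quotient_eq_two 𝔭₁ hcard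
  have h2P' : (2 : 𝓞 ↥(IntermediateField.adjoin ℚ ({β} : Set (AlgebraicClosure ℚ)))) ∉ 𝔭₁ ^ 2 := two_not_mem_sq_of_not_dvd_discr hd 𝔭₁ h2P
  have hunits := forall_units_sub_one_mem_or_add_one_mem_of_rank_eq_one hoddK hrank 𝔭₁ hP0 hres h2P h2P' hε hnsq
  -- Fukuda index `0`, the generator certificate, and this seat's door from `rank₂ Cl(K_1) ≤ 1`
  have hκ0 : TotallyRamifiedFrom κP 0 := totallyRamifiedFrom_zero_of_not_dvd_discr hodd3 hd κP hκP
  have hc := not_exists_eq_conj_div_mul_sq_of_genusCert_layer hodd3 hd κP hκP hh m 𝔭₁ hres h2P hunits hπ hA0 hA σ hcA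
  have hu' : ¬ ((2 : ℕ) : ℤ) ∣ u.eval 1 := by exact_mod_cast hu
  have hF' : (∑ i ∈ range N, C (f i) * X ^ i : ℤ[X]) = (X - 1) ^ d * u + C (((2 : ℕ) : ℤ)) * g := by exact_mod_cast hF
  exact classicalMuVanishes_and_classicalLambda_le_of_relation_of_classGroupPRank_one_le_one κP hκ0 hm h1 σ hσ hc
    (by exact_mod_cast hd2) hu' hF' hrel

end Summit.BirchSwinnertonDyer.BirchSwinnertonDyer.Theorems.AlignedTransportAtTwoCubicSplitStratumRelationDoor

end
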